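import Summits.ResolutionOfSingularities.ResolutionOfSingularities.Theorems.FrobeniusLadderFRationalResolutionIsolatedQuotientResolutionField
import HarnessLib

/-!
# Crux `FrobeniusLadder.FRationalResolution` (stmt-ResolutionOfSingularities-15317), line `redirect`,
# stub `stub_diagonalizableQuotientResolution` — ISOLATED singularities that are ZARISKI-LOCALLY diagonalizable
# quotients are resolvable over an ARBITRARY field (tame or wild, any dimension)

`…IsolatedQuotientResolutionField.hasResolution_of_isolated_quotient_charts` (✓ p825851 era) resolves isolated
singularities under étale quotient charts `φ : Spec S₀ → X` at whose chart point `v ↦ x` the residue map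
`𝒪_{X,x} → κ(v)` is onto. When the chart is an OPEN IMMERSION (the singularity is Zariski-locally — not only
étale-locally — the spectrum of the invariants `S₀ = S^{D(A)}` of a diagonalizable group acting on a regular
`K`-algebra `S` of finite type; e.g. every split quotient singularity `𝔸ⁿ_K / D(A)` and every variety glued from such
affine pieces), the stalk map is an isomorphism and the residue condition is EMPTY. Hence, over ANY field `K`
(finite, imperfect, …):

* `residue_condition_of_isIso_stalkMap` — the residue condition at `v` holds whenever `φ.stalkMap v` is an iso;
* **`hasResolution_of_isolated_zariski_quotient_charts`** — `X` integral, locally of finite type over a field `K`,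
  finitely many singular points, each inside an open `Spec S₀ ↪ X` with `S` regular of finite type graded by a finite
  abelian group ⇒ `Scheme.HasResolution X`;
* `hasResolution_of_zariski_quotient_surface` — the same in dimension `≤ 2` with the stub's `hq` shape (open
  immersions instead of étale charts), finiteness of the singular locus by `…DiagQuotientSurface`.

Honest label: a corollary slice of `stub_diagonalizableQuotientResolution` (Zariski-local charts, isolated
singularities, any field); the étale-local `K ≠ K̄` isolated case remains open design (lanes G / W of the memos).
No stub closed by name. No definitions, no named facts, no sorry. [cite: Kato1994, (10.4)] [folklore; cite: Kollar2007, §2.2]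
-/

noncomputable section

-- single-problem summit: the doubled namespace component is forced
set_option linter.dupNamespace false

open CategoryTheory AlgebraicGeometry
open Literature.AlgebraicGeometry.Resolution
open Summit.ResolutionOfSingularities.ResolutionOfSingularities.Theorems.FRationalResolution

namespace Summit.ResolutionOfSingularities.ResolutionOfSingularities.Theorems.FRationalResolution.IsolatedQuotientResolutionZariski

/-- **The residue condition of brick E-k is empty when the stalk map is an isomorphism** (e.g. for an open
immersion): every germ at `v` IS the pull-back of a germ at `φ v`. [folklore] -/
theorem residue_condition_of_isIso_stalkMap {Y X : Scheme.{0}} (φ : Y ⟶ X) (v : Y) [IsIso (φ.stalkMap v)] :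
    ∀ c : Y.presheaf.stalk v, ∃ b : X.presheaf.stalk (φ v),
      c - (φ.stalkMap v).hom b ∈ IsLocalRing.maximalIdeal (Y.presheaf.stalk v) := by
  intro c
  refine ⟨(inv (φ.stalkMap v)).hom c, ?_⟩
  have h : (φ.stalkMap v).hom ((inv (φ.stalkMap v)).hom c) = c := by
    change (inv (φ.stalkMap v) ≫ φ.stalkMap v).hom c = c
    rw [IsIso.inv_hom_id]
    rfl
  rw [h, sub_self]
  exact Ideal.zero_mem _

/-- **ISOLATED singularities which are ZARISKI-locally diagonalizable quotients are resolvable over ANY field (tame or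
wild, any dimension).** Let `X` be integral, locally of finite type over a field `K`, with finitely many singular
points, each contained in an open subscheme `Spec S₀ ↪ X` where `S` is a REGULAR `K`-algebra of finite type graded by
a finite abelian group `A` and `S₀ = 𝒮 0`. Then `X` has a resolution of singularities.
[cite: Kato1994, (10.4)] [cite: Kollar2007, §2.2] [folklore; cite: SGA3, Exp. VIII §4–5] -/
theorem hasResolution_of_isolated_zariski_quotient_charts (K : Type) [Field K]
    (X : Scheme.{0}) [IsIntegral X] (f : X ⟶ Spec (.of K)) [LocallyOfFiniteType f]
    (hfin : (Scheme.regularLocus X)ᶜ.Finite)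
    (hq : ∀ x : X, x ∉ Scheme.regularLocus X →
      ∃ (A : Type) (_ : AddCommGroup A) (_ : Finite A) (_ : DecidableEq A)
        (S : Type) (_ : CommRing S) (_ : Algebra K S) (𝒮 : A → Submodule K S)
        (_ : GradedAlgebra 𝒮), Algebra.FiniteType K S ∧ IsRegularRing S ∧
        ∃ φ : Spec (.of (𝒮 0)) ⟶ X, IsOpenImmersion φ ∧ x ∈ Set.range φ) :
    Scheme.HasResolution X := by
  refine IsolatedQuotientResolutionField.hasResolution_of_isolated_quotient_charts K X f hfin fun x hx => ?_
  obtain ⟨A, iA, fA, dA, S, iS, aS, 𝒮, gS, hft, hregS, φ, hφ, ⟨v, hv⟩⟩ := hq x hx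
  haveI := hφ
  exact ⟨A, iA, fA, dA, S, iS, aS, 𝒮, gS, hft, hregS, φ, inferInstance, v, hv,
    residue_condition_of_isIso_stalkMap φ v⟩

/-- **Zariski-locally diagonalizable quotient SURFACES are resolvable over ANY field**: `X` integral of dimension
`≤ 2`, every point inside an open `Spec S₀ ↪ X` over `K` (`S` regular of finite type graded by a finite abelian
group); the singular locus is finite by `…DiagQuotientSurface`. [cite: Kato1994, (10.4)] [cite: Lipman1978, §2] -/
theorem hasResolution_of_zariski_quotient_surface (K : Type) [Field K]
    (X : Scheme.{0}) (g : X ⟶ Spec (.of K)) [IsIntegral X] [LocallyOfFiniteType g] [QuasiCompact g]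
    (hq : ∀ x : X, ∃ (A : Type) (_ : AddCommGroup A) (_ : Finite A) (_ : DecidableEq A)
        (S : Type) (_ : CommRing S) (_ : Algebra K S) (𝒮 : A → Submodule K S)
        (_ : GradedAlgebra 𝒮), Algebra.FiniteType K S ∧ IsRegularRing S ∧
        ∃ φ : Spec (.of (𝒮 0)) ⟶ X, IsOpenImmersion φ ∧ x ∈ Set.range φ ∧
          φ ≫ g = Spec.map (CommRingCat.ofHom (algebraMap K (𝒮 0))))
    (hdim : topologicalKrullDim X ≤ 2) :
    Scheme.HasResolution X := by
  have hq' : ∀ x : X, ∃ (A : Type) (_ : AddCommGroup A) (_ : Finite A) (_ : DecidableEq A)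
      (S : Type) (_ : CommRing S) (_ : Algebra K S) (𝒮 : A → Submodule K S)
      (_ : GradedAlgebra 𝒮), Algebra.FiniteType K S ∧ IsRegularRing S ∧
      ∃ φ : Spec (.of (𝒮 0)) ⟶ X, Etale φ ∧ x ∈ Set.range φ ∧
        φ ≫ g = Spec.map (CommRingCat.ofHom (algebraMap K (𝒮 0))) := by
    intro x
    obtain ⟨A, iA, fA, dA, S, iS, aS, 𝒮, gS, hft, hreg, φ, hφ, hx, hg⟩ := hq x
    haveI := hφ
    exact ⟨A, iA, fA, dA, S, iS, aS, 𝒮, gS, hft, hreg, φ, inferInstance, hx, hg⟩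
  obtain ⟨hfin, -⟩ := DiagQuotientSurface.diagQuotient_surface_singularLocus K X g hq' hdim
  refine hasResolution_of_isolated_zariski_quotient_charts K X g hfin fun x _ => ?_
  obtain ⟨A, iA, fA, dA, S, iS, aS, 𝒮, gS, hft, hreg, φ, hφ, hx, -⟩ := hq x
  exact ⟨A, iA, fA, dA, S, iS, aS, 𝒮, gS, hft, hreg, φ, hφ, hx⟩

end Summit.ResolutionOfSingularities.ResolutionOfSingularities.Theorems.FRationalResolution.IsolatedQuotientResolutionZariski

end
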